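import Mathlib

/-!
# Lex-greedy sets along a pencil of heights, I: Gale dominance, the combinatorial lemma, critical parameters

Infrastructure for the chart-monotonicity theorem `lexGreedy_chart_monotone`
(`NewtonUnitEquationsDissociatedUniformChartSweep`), part of Theorem Q (quasi-polynomial vertex bound on dissociated frames)
of line `greedy-basis-shadow` for crux stmt-ValiantsHypothesis-5905 (`NewtonUnitEquations.DissociatedUniform`).

* `GreedyGale.gset` — the lex-greedy set (from the top) of a vector configuration for a weight; it spans from above
  (`mem_span_gset_ge`), is linearly independent for injective weights, and Gale-dominates every independent set
  (`card_filter_le_of_linearIndependent`).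
* `ComboLemma.sum_le_sum_of_dominance` — dominance of upper sets turns into domination of rank sums.
* `Sweep.hgt`, `Sweep.crit` — heights `u + λ v` along a chart and their finitely many critical parameters; between
  critical parameters the strict order (hence the greedy set) is constant (`lt_iff_lt_of_no_crit`, `gset_congr`).
[folklore: greedy bases of matroids / parametric exchange]
-/

set_option linter.dupNamespace false

namespace Summit.ValiantsHypothesis.ValiantsHypothesis.Theorems.NewtonUnitEquationsDissociatedUniform

open scoped BigOperators

namespace GreedyGale

variable {α : Type} {K V : Type*} [DivisionRing K] [AddCommGroup V] [Module K V]

/-- The lex-greedy set of `y` on `L` for the weight `w` (large weights first). -/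
def gset (L : Finset α) (y : α → V) (w : α → ℝ) : Set α :=
  {e | e ∈ L ∧ y e ∉ Submodule.span K (y '' {e' : α | e' ∈ L ∧ w e < w e'})}

omit [DivisionRing K] [AddCommGroup V] [Module K V] in
/-- Unfolding of membership in `gset`. -/
theorem mem_gset {L : Finset α} {y : α → V} {w : α → ℝ} [DivisionRing K] [AddCommGroup V] [Module K V] {e : α} :
    e ∈ gset (K := K) L y w ↔ e ∈ L ∧ y e ∉ Submodule.span K (y '' {e' : α | e' ∈ L ∧ w e < w e'}) :=
  Iff.rfl

/-- **The greedy set spans from above**: every `y e`, `e ∈ L`, lies in the span of the greedy vectors of weight `≥ w e`.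
[folklore] -/
theorem mem_span_gset_ge (L : Finset α) (y : α → V) (w : α → ℝ) :
    ∀ e ∈ L, y e ∈ Submodule.span K (y '' {g : α | g ∈ gset (K := K) L y w ∧ w e ≤ w g}) := by
  classical
  -- strong induction on the number of elements of `L` strictly above `e`
  suffices h : ∀ n : ℕ, ∀ e ∈ L, (L.filter fun e' => w e < w e').card = n →
      y e ∈ Submodule.span K (y '' {g : α | g ∈ gset (K := K) L y w ∧ w e ≤ w g}) from
    fun e he => h _ e he rfl
  intro n
  induction n using Nat.strong_induction_on with
  | _ n ih =>
    intro e he hn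
    by_cases hg : e ∈ gset (K := K) L y w
    · exact Submodule.subset_span ⟨e, ⟨hg, le_rfl⟩, rfl⟩
    · -- `y e` is spanned by strictly higher elements, each of which is spanned by greedy elements above it
      have hmem : y e ∈ Submodule.span K (y '' {e' : α | e' ∈ L ∧ w e < w e'}) := by
        by_contra hnot
        exact hg ⟨he, hnot⟩
      refine Submodule.span_le.mpr ?_ hmem
      rintro _ ⟨e', ⟨he'L, hlt⟩, rfl⟩
      have hcard : (L.filter fun e'' => w e' < w e'').card < n := by
        rw [← hn]
        apply Finset.card_lt_card
        refine ⟨fun e'' he'' => ?_, ?_⟩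
        · rw [Finset.mem_filter] at he'' ⊢
          exact ⟨he''.1, hlt.trans he''.2⟩
        · intro hsub
          have : e' ∈ L.filter fun e'' => w e' < w e'' :=
            hsub (Finset.mem_filter.mpr ⟨he'L, hlt⟩)
          exact lt_irrefl _ (Finset.mem_filter.mp this).2
      have h' := ih _ hcard e' he'L rfl
      refine Submodule.span_mono ?_ h'
      rintro _ ⟨g, ⟨hg', hle⟩, rfl⟩
      exact ⟨g, ⟨hg', hlt.le.trans hle⟩, rfl⟩

/-- The greedy vectors of weight `> τ` span all vectors of weight `> τ`. [folklore] -/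
theorem span_upper_le (L : Finset α) (y : α → V) (w : α → ℝ) (τ : ℝ) :
    Submodule.span K (y '' {e : α | e ∈ L ∧ τ < w e}) ≤
      Submodule.span K (y '' {g : α | g ∈ gset (K := K) L y w ∧ τ < w g}) := by
  refine Submodule.span_le.mpr ?_
  rintro _ ⟨e, ⟨heL, hτ⟩, rfl⟩
  refine Submodule.span_mono ?_ (mem_span_gset_ge (K := K) L y w e heL)
  rintro _ ⟨g, ⟨hg, hle⟩, rfl⟩
  exact ⟨g, ⟨hg, hτ.trans_le hle⟩, rfl⟩

/-- **Gale dominance.**  A linearly independent subfamily of `L` has, above every threshold, at most as many elements as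
the greedy set. [folklore] -/
theorem card_filter_le_of_linearIndependent [Module.Finite K V] (L : Finset α) (y : α → V) (w : α → ℝ)
    (I : Finset α) (hIL : I ⊆ L) (hI : LinearIndependent K (fun e : I => y e)) (τ : ℝ)
    (G : Finset α) (hG : ∀ e, e ∈ G ↔ e ∈ gset (K := K) L y w) :
    (I.filter fun e => τ < w e).card ≤ (G.filter fun e => τ < w e).card := by
  classical
  -- the `I`-vectors above `τ` are independent inside the span of the `G`-vectors above `τ`
  set S : Submodule K V := Submodule.span K (y '' {g : α | g ∈ gset (K := K) L y w ∧ τ < w g}) with hS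
  have hsub : ∀ e ∈ I.filter (fun e => τ < w e), y e ∈ S := by
    intro e he
    rw [Finset.mem_filter] at he
    exact span_upper_le (K := K) L y w τ (Submodule.subset_span ⟨e, ⟨hIL he.1, he.2⟩, rfl⟩)
  -- restrict the independent family to the filter and push it into `S`
  have hI' : LinearIndependent K (fun e : (I.filter fun e => τ < w e) => (⟨y e, hsub e e.2⟩ : S)) := by
    have h1 : LinearIndependent K (fun e : (I.filter fun e => τ < w e) => y e) := by
      let emb : (I.filter fun e => τ < w e) → I := fun e => ⟨e, (Finset.mem_filter.mp e.2).1⟩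
      have hemb : Function.Injective emb := by
        intro a b hab
        apply Subtype.ext
        have := congrArg Subtype.val hab
        simpa [emb] using this
      exact hI.comp emb hemb
    refine LinearIndependent.of_comp S.subtype ?_
    simpa [Function.comp_def] using h1
  have hle := hI'.fintype_card_le_finrank
  rw [Fintype.card_coe] at hle
  -- `finrank S ≤ #(G-vectors above τ) ≤ #(G.filter …)`
  have hspan : Module.finrank K S ≤ (G.filter fun e => τ < w e).card := by
    have himg : (y '' {g : α | g ∈ gset (K := K) L y w ∧ τ < w g}) =
        ((G.filter fun e => τ < w e).image y : Set V) := by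
      ext z
      simp only [Set.mem_image, Set.mem_setOf_eq, Finset.coe_image, Finset.coe_filter, hG]
    rw [hS, himg]
    exact (finrank_span_finset_le_card _).trans Finset.card_image_le
  exact hle.trans hspan

/-- **Greedy vectors are linearly independent** (weights injective on `L`): in a vanishing combination the element of
smallest weight with a nonzero coefficient would be spanned by strictly heavier ones. [folklore] -/
theorem linearIndependent_gset (L : Finset α) (y : α → V) (w : α → ℝ) (hinj : Set.InjOn w L) (G : Finset α)
    (hG : ∀ e ∈ G, e ∈ gset (K := K) L y w) : LinearIndependent K (fun e : G => y e) := by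
  classical
  rw [Fintype.linearIndependent_iff]
  intro g hsum
  by_contra hne
  push Not at hne
  obtain ⟨i₀, hi₀mem, hi₀min⟩ := Finset.exists_min_image (Finset.univ.filter fun i : G => g i ≠ 0)
    (fun i => w i) (by
      obtain ⟨i, hi⟩ := hne
      exact ⟨i, Finset.mem_filter.mpr ⟨Finset.mem_univ _, hi⟩⟩)
  have hg₀ : g i₀ ≠ 0 := (Finset.mem_filter.mp hi₀mem).2
  have hi₀L : (i₀ : α) ∈ L := (hG i₀ i₀.2).1
  have hsplit : g i₀ • y i₀ = -∑ i ∈ Finset.univ.erase i₀, g i • y (i : α) := by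
    rw [← Finset.add_sum_erase Finset.univ (fun i : G => g i • y (i : α)) (Finset.mem_univ i₀)] at hsum
    exact eq_neg_of_add_eq_zero_left hsum
  have hx : y i₀ = (g i₀)⁻¹ • -∑ i ∈ Finset.univ.erase i₀, g i • y (i : α) := by
    rw [← hsplit, smul_smul, inv_mul_cancel₀ hg₀, one_smul]
  have hmem : y i₀ ∈ Submodule.span K (y '' {e' : α | e' ∈ L ∧ w i₀ < w e'}) := by
    rw [hx]
    refine Submodule.smul_mem _ _ (Submodule.neg_mem _ (Submodule.sum_mem _ fun i hi => ?_))
    by_cases hgi : g i = 0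
    · rw [hgi, zero_smul]; exact Submodule.zero_mem _
    · refine Submodule.smul_mem _ _ (Submodule.subset_span ⟨(i : α), ⟨(hG i i.2).1, ?_⟩, rfl⟩)
      have hle : w i₀ ≤ w i := hi₀min i (Finset.mem_filter.mpr ⟨Finset.mem_univ _, hgi⟩)
      refine lt_of_le_of_ne hle fun heq => ?_
      have : (i₀ : α) = (i : α) := hinj hi₀L (hG i i.2).1 heq
      exact (Finset.mem_erase.mp hi).1 (Subtype.ext this).symm
  exact (hG i₀ i₀.2).2 hmem

end GreedyGale

namespace ComboLemma

variable {α : Type}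

/-- Prefix dominance ⇒ rank-sum dominance, with the equality case. [folklore] -/
theorem sum_le_sum_of_dominance (L : Finset α) (v : α → ℝ) (hv : Set.InjOn v L) (r : α → ℕ)
    (hr : ∀ a ∈ L, ∀ b ∈ L, v a < v b → r a < r b) :
    ∀ n : ℕ, ∀ S T : Finset α, S ⊆ L → T ⊆ L → S.card = n → T.card = n →
      (∀ τ : ℝ, (S.filter fun e => τ < v e).card ≤ (T.filter fun e => τ < v e).card) →
      (∑ e ∈ S, r e ≤ ∑ e ∈ T, r e) ∧ (∑ e ∈ S, r e = ∑ e ∈ T, r e → S = T) := by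
  classical
  intro n
  induction n with
  | zero =>
    intro S T _ _ hS hT _
    rw [Finset.card_eq_zero] at hS hT
    subst hS; subst hT
    simp
  | succ n ih =>
    intro S T hSL hTL hS hT hdom
    have hSne : S.Nonempty := Finset.card_pos.mp (by omega)
    have hTne : T.Nonempty := Finset.card_pos.mp (by omega)
    obtain ⟨s, hsS, hsmax⟩ := Finset.exists_max_image S v hSne
    obtain ⟨t, htT, htmax⟩ := Finset.exists_max_image T v hTne
    -- no element of `S` lies above `v t`
    have hst : v s ≤ v t := by
      by_contra hlt
      push Not at hlt
      have h1 : (S.filter fun e => v t < v e).card ≤ (T.filter fun e => v t < v e).card := hdom (v t)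
      have h2 : (T.filter fun e => v t < v e).card = 0 := by
        rw [Finset.card_eq_zero, Finset.filter_eq_empty_iff]
        intro e he hlt'
        exact absurd (htmax e he) (not_le.mpr hlt')
      have h3 : s ∈ S.filter fun e => v t < v e := Finset.mem_filter.mpr ⟨hsS, hlt⟩
      have h4 : 0 < (S.filter fun e => v t < v e).card := Finset.card_pos.mpr ⟨s, h3⟩
      omega
    have hrst : r s ≤ r t := by
      rcases hst.lt_or_eq with hlt | heq
      · exact (hr s (hSL hsS) t (hTL htT) hlt).le
      · have : s = t := hv (hSL hsS) (hTL htT) heq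
        rw [this]
    -- dominance for the erased sets
    have hdom' : ∀ τ : ℝ, ((S.erase s).filter fun e => τ < v e).card ≤ ((T.erase t).filter fun e => τ < v e).card := by
      intro τ
      by_cases hτ : τ < v s
      · -- below `v s ≤ v t`: both lose exactly one element
        have eS : ((S.erase s).filter fun e => τ < v e) = (S.filter fun e => τ < v e).erase s := by
          ext e; simp only [Finset.mem_filter, Finset.mem_erase]; tauto
        have eT : ((T.erase t).filter fun e => τ < v e) = (T.filter fun e => τ < v e).erase t := by
          ext e; simp only [Finset.mem_filter, Finset.mem_erase]; tauto
        rw [eS, eT, Finset.card_erase_of_mem (Finset.mem_filter.mpr ⟨hsS, hτ⟩),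
          Finset.card_erase_of_mem (Finset.mem_filter.mpr ⟨htT, hτ.trans_le hst⟩)]
        exact Nat.sub_le_sub_right (hdom τ) 1
      · -- at or above `v s`: nothing of `S` remains
        push Not at hτ
        have : ((S.erase s).filter fun e => τ < v e) = ∅ := by
          rw [Finset.filter_eq_empty_iff]
          intro e he hlt
          exact absurd ((hsmax e (Finset.mem_erase.mp he).2).trans hτ) (not_le.mpr hlt)
        rw [this, Finset.card_empty]
        exact Nat.zero_le _
    have hS' : (S.erase s).card = n := by rw [Finset.card_erase_of_mem hsS, hS]; rfl
    have hT' : (T.erase t).card = n := by rw [Finset.card_erase_of_mem htT, hT]; rfl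
    obtain ⟨hle, heqc⟩ := ih (S.erase s) (T.erase t) ((Finset.erase_subset s S).trans hSL)
      ((Finset.erase_subset t T).trans hTL) hS' hT' hdom'
    rw [← Finset.add_sum_erase S r hsS, ← Finset.add_sum_erase T r htT]
    refine ⟨Nat.add_le_add hrst hle, fun heq => ?_⟩
    have h1 : r s = r t := by omega
    have h2 : ∑ e ∈ S.erase s, r e = ∑ e ∈ T.erase t, r e := by omega
    have hST : S.erase s = T.erase t := heqc h2
    have hst' : s = t := by
      rcases hst.lt_or_eq with hlt | heq'
      · exact absurd h1 (hr s (hSL hsS) t (hTL htT) hlt).ne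
      · exact hv (hSL hsS) (hTL htT) heq'
    rw [← Finset.insert_erase hsS, ← Finset.insert_erase htT, hST, hst']

end ComboLemma

/-! ## Heights along a chart and critical parameters -/

namespace Sweep

variable {α : Type} {K V : Type*} [DivisionRing K] [AddCommGroup V] [Module K V]

open scoped Classical

/-- Heights along the chart. -/
def hgt (u v : α → ℝ) (lam : ℝ) : α → ℝ := fun e => u e + lam * v e

/-- The critical parameters: where two elements of `E` with different slopes have equal height. -/
noncomputable def crit (E : Finset α) (u v : α → ℝ) : Finset ℝ :=
  ((E ×ˢ E).filter fun p => v p.1 ≠ v p.2).image fun p => (u p.2 - u p.1) / (v p.1 - v p.2)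

/-- Equal heights of two elements with different slopes happen only at a critical parameter. -/
theorem mem_crit_of_eq (E : Finset α) (u v : α → ℝ) {e e' : α} (he : e ∈ E) (he' : e' ∈ E) (hv : v e ≠ v e')
    {lam : ℝ} (h : hgt u v lam e = hgt u v lam e') : lam ∈ crit E u v := by
  unfold crit
  refine Finset.mem_image.mpr ⟨(e, e'), Finset.mem_filter.mpr ⟨Finset.mem_product.mpr ⟨he, he'⟩, hv⟩, ?_⟩
  unfold hgt at h
  have hv' : v e - v e' ≠ 0 := sub_ne_zero.mpr hv
  field_simp
  linarith

/-- Off the critical set, heights are injective on `E` as soon as they are injective at one parameter. -/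
theorem injOn_of_not_mem_crit (E : Finset α) (u v : α → ℝ) {lam₀ : ℝ} (h₀ : Set.InjOn (hgt u v lam₀) E) {lam : ℝ}
    (hlam : lam ∉ crit E u v) : Set.InjOn (hgt u v lam) E := by
  intro e he e' he' heq
  by_contra hne
  by_cases hv : v e = v e'
  · -- equal slopes and equal heights force equal offsets, contradicting injectivity at `lam₀`
    have hu : u e = u e' := by unfold hgt at heq; rw [hv] at heq; linarith
    exact hne (h₀ he he' (by unfold hgt; rw [hu, hv]))
  · exact hlam (mem_crit_of_eq E u v he he' hv heq)

/-- An injective parameter is not critical. -/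
theorem not_mem_crit_of_injOn (E : Finset α) (u v : α → ℝ) {lam : ℝ} (h : Set.InjOn (hgt u v lam) E) :
    lam ∉ crit E u v := by
  intro hmem
  unfold crit at hmem
  obtain ⟨⟨e, e'⟩, hp, hlam⟩ := Finset.mem_image.mp hmem
  obtain ⟨hp1, hv⟩ := Finset.mem_filter.mp hp
  obtain ⟨he, he'⟩ := Finset.mem_product.mp hp1
  simp only at hv hlam
  have heq : hgt u v lam e = hgt u v lam e' := by
    unfold hgt
    have hv' : v e - v e' ≠ 0 := sub_ne_zero.mpr hv
    rw [← hlam]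
    field_simp
    ring
  exact hv (congrArg v (h he he' heq))

/-- **Sign persistence**: an order relation between two elements persists along an interval free of critical values. -/
theorem lt_iff_lt_of_no_crit (E : Finset α) (u v : α → ℝ) {a b : ℝ} (hab : a ≤ b)
    (hfree : ∀ c ∈ crit E u v, ¬ (a ≤ c ∧ c ≤ b)) {e e' : α} (he : e ∈ E) (he' : e' ∈ E) :
    hgt u v a e < hgt u v a e' ↔ hgt u v b e < hgt u v b e' := by
  -- the affine function `μ ↦ hgt μ e' - hgt μ e` has no zero on `[a, b]`
  have key : ∀ {p q : α}, p ∈ E → q ∈ E → hgt u v a p < hgt u v a q → hgt u v b p < hgt u v b q := by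
    intro p q hp hq hlt
    by_contra hge
    push Not at hge
    rcases hge.lt_or_eq with hgt' | heq
    · -- strict sign change ⇒ a root strictly inside, which is critical
      by_cases hv : v p = v q
      · unfold hgt at hlt hgt'; rw [hv] at hlt hgt'; linarith
      · set μ := (u q - u p) / (v p - v q) with hμ
        have hroot : hgt u v μ p = hgt u v μ q := by
          unfold hgt; rw [hμ]
          have : v p - v q ≠ 0 := sub_ne_zero.mpr hv
          field_simp; ring
        have hμcrit : μ ∈ crit E u v := mem_crit_of_eq E u v hp hq hv hroot
        -- `μ` lies between `a` and `b`: the affine difference is positive at `a`, negative at `b`, zero at `μ`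
        have hlin : ∀ t : ℝ, hgt u v t q - hgt u v t p = (u q - u p) + t * (v q - v p) := by
          intro t; unfold hgt; ring
        have h1 : 0 < (u q - u p) + a * (v q - v p) := by rw [← hlin]; linarith
        have h2 : (u q - u p) + b * (v q - v p) < 0 := by rw [← hlin]; linarith
        have h3 : (u q - u p) + μ * (v q - v p) = 0 := by rw [← hlin, hroot, sub_self]
        have hvne : v q - v p ≠ 0 := sub_ne_zero.mpr (Ne.symm hv)
        have haμ : a ≤ μ := by
          by_contra h; push Not at h
          rcases lt_or_gt_of_ne hvne with hneg | hpos
          · nlinarith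
          · nlinarith
        have hμb : μ ≤ b := by
          by_contra h; push Not at h
          rcases lt_or_gt_of_ne hvne with hneg | hpos
          · nlinarith
          · nlinarith
        exact hfree μ hμcrit ⟨haμ, hμb⟩
    · -- equal heights at `b` ⇒ `b` itself is critical (or equal slopes, impossible)
      by_cases hv : v p = v q
      · unfold hgt at hlt heq; rw [hv] at hlt heq; linarith
      · exact hfree b (mem_crit_of_eq E u v hp hq hv heq.symm) ⟨hab, le_rfl⟩
  constructor
  · exact key he he'
  · intro h
    rcases lt_trichotomy (hgt u v a e) (hgt u v a e') with hlt | heq | hgt'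
    · exact hlt
    · -- equal at `a`: then `a` is critical or the slopes (hence offsets) agree, contradicting strictness at `b`
      by_cases hv : v e = v e'
      · unfold hgt at heq h; rw [hv] at heq h; linarith
      · exact absurd ⟨le_rfl, hab⟩ (hfree a (mem_crit_of_eq E u v he he' hv heq))
    · exact absurd h (lt_asymm (key he' he hgt'))

/-- Greedy sets depend only on the strict order of the heights. -/
theorem gset_congr (E : Finset α) (x : α → V) {w w' : α → ℝ}
    (h : ∀ e ∈ E, ∀ e' ∈ E, w e < w e' ↔ w' e < w' e') :
    GreedyGale.gset (K := K) E x w = GreedyGale.gset (K := K) E x w' := by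
  ext e
  rw [GreedyGale.mem_gset, GreedyGale.mem_gset]
  constructor
  · rintro ⟨he, hnot⟩
    refine ⟨he, fun hmem => hnot ?_⟩
    have : {e' : α | e' ∈ E ∧ w' e < w' e'} = {e' : α | e' ∈ E ∧ w e < w e'} := by
      ext e'; simp only [Set.mem_setOf_eq]
      exact ⟨fun h' => ⟨h'.1, (h e he e' h'.1).mpr h'.2⟩, fun h' => ⟨h'.1, (h e he e' h'.1).mp h'.2⟩⟩
    rwa [this] at hmem
  · rintro ⟨he, hnot⟩
    refine ⟨he, fun hmem => hnot ?_⟩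
    have : {e' : α | e' ∈ E ∧ w e < w e'} = {e' : α | e' ∈ E ∧ w' e < w' e'} := by
      ext e'; simp only [Set.mem_setOf_eq]
      exact ⟨fun h' => ⟨h'.1, (h e he e' h'.1).mp h'.2⟩, fun h' => ⟨h'.1, (h e he e' h'.1).mpr h'.2⟩⟩
    rwa [this] at hmem

end Sweep

/-- **Gale dominance, definition-free export** (`V = ℂ^k`): above every threshold, a linearly independent subfamily of
`E` has at most as many elements as the lex-greedy set. [folklore: Gale's optimality of greedy bases] -/
theorem lexGreedy_gale_dominance (α : Type) (k : ℕ) (E : Finset α) (x : α → Fin k → ℂ) (w : α → ℝ) (I : Finset α)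
    (hIE : I ⊆ E) (hI : LinearIndependent ℂ (fun e : I => x e)) (τ : ℝ) :
    (I.filter fun e => τ < w e).card ≤
      Set.ncard {e : α | (e ∈ E ∧ x e ∉ Submodule.span ℂ (x '' {e' : α | e' ∈ E ∧ w e < w e'})) ∧ τ < w e} := by
  classical
  have hfin : (GreedyGale.gset (K := ℂ) E x w).Finite := (E.finite_toSet).subset fun e he => he.1
  set G : Finset α := hfin.toFinset with hG
  have hGmem : ∀ e, e ∈ G ↔ e ∈ GreedyGale.gset (K := ℂ) E x w := fun e => Set.Finite.mem_toFinset _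
  have h := GreedyGale.card_filter_le_of_linearIndependent (K := ℂ) E x w I hIE hI τ G hGmem
  refine h.trans (le_of_eq ?_)
  rw [← Set.ncard_coe_finset]
  congr 1
  ext e
  simp only [Finset.coe_filter, Set.mem_setOf_eq, hGmem, GreedyGale.mem_gset]

end Summit.ValiantsHypothesis.ValiantsHypothesis.Theorems.NewtonUnitEquationsDissociatedUniform
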